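import Summits.QuantumFields.YangMills.Theorems.BalabanUVNodesN22W1RelCentredMembersOfDatum
import Literature.MathematicalPhysics.QuantumFieldTheory.Balaban1983to89.B13Bound226BoxTail

/-!
# BalabanUVNodes ∕ node N22 = NE9 — THE W1 OBJECT ON THE RELATIVE-DISC CENTRED ROAD (RE-TYPING M1′), MODULE J7a: THE TAILS OF (S-vertex-T′)ʷ FOR THE MEMBER FAMILY OF THE
# DATUM, KERNEL-KEYED — the BOX TAIL (`P = ∅`), the `b`-FREE BOX-FREE CENTRE, and the LARGE-FIELD members (`P ≠ ∅`): dag-n10-c g6's `B13Bound226BoxTail` §2 ∕ §3 ∕ §4 (lens T24 ∕ T25)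
# read at the datum's kernel record, for J5's window-dilated member of base point `s₀`

Cell `pub-ymgap`, HUMAN RULING D-0062 (Track A), R134 ACCELERATION re-seat `pub-ymgap-dag-n22-c` (strategy s1), generation 7, file J7a.  THEOREMS ONLY; imports J5
`…N22W1RelCentredMembersOfDatum` (the member family at lambda level; W1-7 `HistoryTermDatum214`) and dag-n10-c g6's `B13Bound226BoxTail` BY NAME.  `--supports` K3⁶
`SpineGivenEndpointR13SepCoPR` (stmt-QuantumFields-20509; dag-lead WORDS-142) as a helper.

WHY.  J2 ∕ J3 ∕ J4 display (S-vertex-T′)ʷ: `‖mF s₀ k′ Z t b old φ − V k′ Z t old φ‖ ≤ Mv·s₀²·(weight·e^{a₅|Z|})` on `ball 1 ρ_b`, with a COUPLING-BLIND centre `V`.  For the member family of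
the datum (J5) the producer's engines (dag-n10-c g6∕g7, lens T21–T26) give it in THREE PIECES (`B13Term214CentredPieces.centred_three_pieces`): for a term WITHOUT large-field boxes,
`‖m(s₀,b) − c₁(b)‖ ≤ s₀²·E₁·W` (the CENTRED (2.15) about the boxed reference member `c₁(b) = term(b²A,bΓ,F214 χᵘ(s₀·) χᶜᵘ(s₀·) 𝐕₀)` with the potentials frozen to the background value
`𝐕₀(Y) = 𝒪(old,φ,Y,0)`: `B13Bound226Centred` ∕ its exponential-letter edition `B13Bound226CentredRem` — J7b), `‖c₁(b) − c(b)‖ ≤ e^{−½κR²}·W` (the BOX TAIL to the box-free member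
`c(b) = term(b²A,bΓ,F214 1 1 𝐕₀)`: §1 here), and `c(b) = V := term(A,Γ,F214 1 1 𝐕₀)` EXACTLY (the box-free centre is `b`-free: §2 here) — `V` has no base point and no dilation
parameter, as J2's slot demands; for a term WITH large-field boxes the whole member is `≤ e^{−½γ₂(r_P²−r₁²)}·W` (§3 here) and `V := 0`.  THIS FILE reads the three `B13Bound226BoxTail`
theorems at the datum's kernel record exactly as J6 reads module 41 §4 (W1-8's located-inputs list at the base point `s₀`, the boxes `χᵘ(s₀·)`, the split potentials `s₀⁻²𝒲(φ,·,s₀·)`,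
`𝒪(old,φ,·,s₀·)`, `K_E`, `ρ_b < 1`, primed letters), leaving the RATES (`e^{−½κR²} ≤ s₀²·T`, `e^{−½γ₂(r_P²−r₁²)} ≤ s₀²·T_P` — `boxTail_rate` with `R = ε₁∕s₀`, `r_P` of the same
growth) to the assembler J7c.

WHAT.  §1 ★ `norm_boxTail_memberOfDatum_le_of_primitives` · §2 ★ `boxFreeCentre_memberOfDatum_eq_of_primitives` · §3 ★ `norm_memberOfDatum_le_largeField_of_primitives` — one application
each (lists `sigmaList_spec` ∕ `tauList_spec`, linearity `rfl`, `hfibΛ` = the kernel record's `hfib`, `C ≻ 0` = the record's `hC`).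

HONEST FRAMING.  Count-neutral kernel-keyed readings of three landed theorems (no estimate proved here); every located input is a HYPOTHESIS (NODE A's kernel letters, the box law and
(2.22) of the unscaled-field boxes at `s₀`, Lemma 2-type letters for `𝒲`∕`𝒪`, numerics); the identification of these boxes ∕ potentials with the datum's display is the
unscaled-field law (J5 ∕ W1-11), not used here; (S-vertex-T′) NOT PRINTED ([I] (2.13) p. 268 records the first-order vanishing only); nothing of Bałaban's asserted; N22 NOT
discharged; one finite four-torus programme at fixed ε — NOT infinite volume, NOT OS on ℝ⁴, NOT a mass gap, NOT Clay.  0 `sorry`, 0 `def`, standard axioms.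

References (TYPES only): [II] = [Balaban1988RG2Cluster] (2.3) p. 12, (2.14)–(2.26) pp. 15–17; [I] = [Balaban1987RG1] §1 p. 263, (2.9)–(2.13) pp. 266–268.
-/

noncomputable section

namespace YMDAG.N22.W1

open Set Metric Matrix
open Literature.MathematicalPhysics.QuantumFieldTheory.Balaban1983to89
open Literature.MathematicalPhysics.QuantumFieldTheory.Balaban1983to89.B13Term214 (term214 core214 F214)
open Literature.MathematicalPhysics.QuantumFieldTheory.Balaban1983to89.B13Bound226BoxTail
  (h226_torus_windowDilated_boxTail_of_primitives term214_torus_windowDilated_boxFree_eq_of_primitives h226_torus_windowDilated_largeField_of_primitives)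
open Literature.MathematicalPhysics.QuantumFieldTheory.Balaban1983to89.TreeLengthTorus (TPt TDom tsys)
open Literature.MathematicalPhysics.QuantumFieldTheory.Balaban1983to89.B13Lemma3TorusTerms (weight)
open Literature.MathematicalPhysics.QuantumFieldTheory.Balaban1983to89.B13Bound143 (invTau)
open Literature.MathematicalPhysics.QuantumFieldTheory.Balaban1983to89.B9Thm37GlueTorus (tdist1)
open Literature.MathematicalPhysics.QuantumFieldTheory.Balaban1983to89.B5TorusCover (UT)
open Literature.MathematicalPhysics.QuantumFieldTheory.Balaban1983to89.Node00.Sect2 (domSys domCount CPair)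
open Literature.MathematicalPhysics.QuantumFieldTheory.Balaban1983to89.Node00.W1

variable {c₀ : B13.Consts} {P : Params} {𝔸 : Type*} {M k L : ℕ} [NeZero L] (𝔇 : TermDatum214 c₀ P 𝔸 M k L)
  (χu χcu : (Z : (domSys P M (k + 1)).Dom) → (t : TermLabel P M k L) → ((𝔇.𝒦 Z t).Λ → ℝ) → ℝ)
  (𝒲 : (Z : (domSys P M (k + 1)).Dom) → (t : TermLabel P M k L) → CPair P 𝔸 → TDom P.d (L * domCount P M (k + 1)) → ((𝔇.𝒦 Z t).Λ → ℝ) → ℂ)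
  (𝒪 : (Z : (domSys P M (k + 1)).Dom) → (t : TermLabel P M k L) → OlderTerms P 𝔸 M k → CPair P 𝔸 → TDom P.d (L * domCount P M (k + 1)) →
    ((𝔇.𝒦 Z t).Λ → ℝ) → ℂ)

/-! ## §1 The box tail at the datum (`P(t) = ∅`): boxed reference member minus box-free member -/

open Classical in
/-- **THE BOX TAIL FOR THE MEMBER FAMILY OF THE DATUM, KERNEL-KEYED (`P(t) = ∅`)** — dag-n10-c g6 `B13Bound226BoxTail.h226_torus_windowDilated_boxTail_of_primitives` (lens T24) at
the datum's kernel record, for the REFERENCE member of base point `s₀` (the member's boxes `χᵘ(s₀·), χᶜᵘ(s₀·)` kept, the potentials FROZEN to the field-constant background value of the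
older terms `𝐕₀(Y) := 𝒪(old, φ, Y, 0)`) minus the BOX-FREE member (boxes replaced by `1`): for every `b ∈ ball 1 ρ_b`,
`‖term(b²A,bΓ,F214 |P| χᵘ(s₀·) χᶜᵘ(s₀·) 𝐃 𝐕₀) − term(b²A,bΓ,F214 |P| 1 1 𝐃 𝐕₀)‖ ≤ e^{−½κR²}·(weight L M c Z a t·e^{a₅|Z|})`.  Located inputs: W1-8's list at the base point as in J6,
the boxes' signs ∕ measurability ∕ `χχᶜ ≤ 1` and the BOX LAW `χχᶜ = 1 on ⟨B′,B′⟩ < R²` (R = ε₁∕s₀ for the unscaled-field boxes, ε₁ absolute — lens E5; displayed), `𝒪(old,φ,Y,0)` with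
`Σ|τ||𝐕₀| ≤ ½a₀‖B′‖² + w₀` on the τ-region, NO large-field boxes (`|P(t)| = 0`), a rate `κ ≥ 0`, `K_E`, `ρ_b < 1` and the primed letters, the numeric conditions at the rate `κ + a₀`
with `w₀`.  With `e^{−½κ(ε₁∕s₀)²} ≤ s₀²·2∕(eκε₁²)` (`B13Term214CentredPieces.boxTail_rate`) this is the `t²·W₂` half of J1's `centred_of_twoStep`.  One application; no estimate proved here.
[cite: Balaban1988RG2Cluster, (2.3) p.12, (2.14)-(2.15) p.15, (2.16)-(2.22) p.16, (2.23)-(2.26) p.17; Balaban1987RG1, (2.9)-(2.13) pp.266-268] -/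
theorem norm_boxTail_memberOfDatum_le_of_primitives
    (Z : (domSys P M (k + 1)).Dom) (t : TermLabel P M k L) (old : OlderTerms P 𝔸 M k) (φ : CPair P 𝔸) (s₀ : ℝ)
    (c : B13.Consts)
    (hκ₁ : 1 ≤ c.κ₁)
    (hα₆ : c.α₆ ≠ 0)
    (hpos : ∀ Y : TDom P.d (L * domCount P M (k + 1)), 0 < invTau c ((tsys P.d (L * domCount P M (k + 1))).dj Y))
    (hhalf : ∀ Y : TDom P.d (L * domCount P M (k + 1)), invTau c ((tsys P.d (L * domCount P M (k + 1))).dj Y) ≤ 1 / 2)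
    {Uσ : Set ℂ}
    {Uτ : TDom P.d (L * domCount P M (k + 1)) → Set ℂ}
    (hUσ : IsOpen Uσ)
    (hUτ : ∀ Y, IsOpen (Uτ Y))
    (hUexp : closedBall (0 : ℂ) (Real.exp c.κ₁) ⊆ Uσ)
    (hUtau : ∀ Y : TDom P.d (L * domCount P M (k + 1)), closedBall (0 : ℂ) ((invTau c ((tsys P.d (L * domCount P M (k + 1))).dj Y))⁻¹) ⊆ Uτ Y)
    (hr : 0 < 𝔇.r)
    (hr' : 𝔇.r ≤ Real.exp c.κ₁ - 1)
    (hsubτ : ∀ Y, ∀ s ∈ Set.uIcc (0 : ℝ) 1, closedBall (s : ℂ) 𝔇.r ⊆ Uτ Y)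
    -- the (2.14)-data AT THE REAL COUPLING (b = 1)
    (hχ0 : ∀ B, 0 ≤ χu Z t (s₀ • B))
    (hχc0 : ∀ B, 0 ≤ χcu Z t (s₀ • B))
    (hχ1 : ∀ B, χu Z t (s₀ • B) * χcu Z t (s₀ • B) ≤ 1)
    {R κ : ℝ}
    (hκ : 0 ≤ κ)
    (hbox : ∀ B, B ⬝ᵥ B < R ^ 2 → χu Z t (s₀ • B) * χcu Z t (s₀ • B) = 1)
    (hAhol : ∀ i j, DifferentiableOn ℂ (fun σ => 𝔇.A Z t φ σ i j) {σ | ∀ j, σ j ∈ Uσ})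
    (hχm : Measurable fun B : (𝔇.𝒦 Z t).Λ → ℝ => χu Z t (s₀ • B))
    (hχcm : Measurable fun B : (𝔇.𝒦 Z t).Λ → ℝ => χcu Z t (s₀ • B))
    (hV₀m : ∀ Y, Measurable fun _B : (𝔇.𝒦 Z t).Λ → ℝ => 𝒪 Z t old φ Y 0)
    (hAs : ∀ σ : TPt P.d (domCount P M (k + 1)) → ℂ, (∀ j, σ j ∈ Uσ) → (𝔇.A Z t φ σ).IsSymm)
    (hGhol : ∀ i j, DifferentiableOn ℂ (fun σ => (𝔇.𝒦 Z t).G2 σ (𝔇.uOf Z t φ) i j) {σ | ∀ j, σ j ∈ Uσ})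
    -- no large-field boxes; the centre's potentials on the open per-domain τ-region
    (hP0 : t.2.card = 0)
    {a₀ w₀ : ℝ}
    (ha₀ : 0 ≤ a₀)
    (h220U : ∀ τ : TDom P.d (L * domCount P M (k + 1)) → ℂ, (∀ Y, τ Y ∈ Uτ Y) →
      ∀ B : (𝔇.𝒦 Z t).Λ → ℝ, ∑ Y ∈ t.1, ‖τ Y‖ * ‖𝒪 Z t old φ Y 0‖ ≤ a₀ / 2 * (B ⬝ᵥ B) + w₀)
    -- bonds located on the torus `UT Nf`
    (hfibN : ∀ x : UT 𝔇.Nf, (Finset.univ.filter fun j => (𝔇.𝒦 Z t).locN j = x).card ≤ (𝔇.𝒦 Z t).m)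
    -- rates and the letters AT b = 1 (+ K_E)
    {kap kap' kap'' θ θE θΓ θC KG KΓ KCs K₀ KE : ℝ}
    (hkap'' : 0 < kap'')
    (hk1 : kap'' < kap')
    (hk2 : kap' < kap)
    (hθE : 0 ≤ θE)
    (hθΓ : 0 ≤ θΓ)
    (hθC : 0 ≤ θC)
    (hKG : 0 ≤ KG)
    (hKΓ : 0 ≤ KΓ)
    (hKCs : 0 ≤ KCs)
    (hK₀ : 0 ≤ K₀)
    (hKE : 0 ≤ KE)
    (hG : ∀ σ : TPt P.d (domCount P M (k + 1)) → ℂ, (∀ j, σ j ∈ Uσ) →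
      ∀ b j, ‖(𝔇.𝒦 Z t).G2 σ (𝔇.uOf Z t φ) b j‖ ≤ KG * Real.exp (-(kap * tdist1 𝔇.Nf ((𝔇.𝒦 Z t).locΛ b) ((𝔇.𝒦 Z t).locN j))))
    (hΓ₀ : ∀ b j, ‖(𝔇.𝒦 Z t).Γ₀ b j‖ ≤ KΓ * Real.exp (-(kap * tdist1 𝔇.Nf ((𝔇.𝒦 Z t).locΛ b) ((𝔇.𝒦 Z t).locN j))))
    (hCs : ∀ σ : TPt P.d (domCount P M (k + 1)) → ℂ, (∀ j, σ j ∈ Uσ) →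
      ∀ b b', ‖(𝔇.A Z t φ σ)⁻¹ b b'‖ ≤ KCs * Real.exp (-(kap * tdist1 𝔇.Nf ((𝔇.𝒦 Z t).locΛ b) ((𝔇.𝒦 Z t).locΛ b'))))
    (hC216 : ∀ b b', ‖(𝔇.𝒦 Z t).C b b'‖ ≤ K₀ * Real.exp (-(kap * tdist1 𝔇.Nf ((𝔇.𝒦 Z t).locΛ b) ((𝔇.𝒦 Z t).locΛ b'))))
    (hCE : ∀ b b', ‖((𝔇.𝒦 Z t).C⁻¹.map (algebraMap ℝ ℂ)) b b'‖ ≤ KE * Real.exp (-(kap * tdist1 𝔇.Nf ((𝔇.𝒦 Z t).locΛ b) ((𝔇.𝒦 Z t).locΛ b'))))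
    (hdΓ : ∀ σ : TPt P.d (domCount P M (k + 1)) → ℂ, (∀ j, σ j ∈ Uσ) →
      ∀ b j, ‖((𝔇.𝒦 Z t).G2 σ (𝔇.uOf Z t φ) - (𝔇.𝒦 Z t).Γ₀.map (algebraMap ℝ ℂ)) b j‖ ≤ θΓ * Real.exp (-(kap * tdist1 𝔇.Nf ((𝔇.𝒦 Z t).locΛ b) ((𝔇.𝒦 Z t).locN j))))
    (hdC : ∀ σ : TPt P.d (domCount P M (k + 1)) → ℂ, (∀ j, σ j ∈ Uσ) →
      ∀ b b', ‖((𝔇.A Z t φ σ)⁻¹ - (𝔇.𝒦 Z t).C.map (algebraMap ℝ ℂ)) b b'‖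
        ≤ θC * Real.exp (-(kap * tdist1 𝔇.Nf ((𝔇.𝒦 Z t).locΛ b) ((𝔇.𝒦 Z t).locΛ b'))))
    (hdE : ∀ σ : TPt P.d (domCount P M (k + 1)) → ℂ, (∀ j, σ j ∈ Uσ) →
      ∀ b b', ‖(𝔇.A Z t φ σ - (𝔇.𝒦 Z t).C⁻¹.map (algebraMap ℝ ℂ)) b b'‖ ≤ θE * Real.exp (-(kap * tdist1 𝔇.Nf ((𝔇.𝒦 Z t).locΛ b) ((𝔇.𝒦 Z t).locΛ b'))))
    {ρb KG' KCs' θΓ' θC' θE' : ℝ}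
    (hρb1 : ρb < 1)
    (hKG' : (1 + ρb) * KG ≤ KG')
    (hKCs' : ((1 - ρb) ^ 2)⁻¹ * KCs ≤ KCs')
    (hθΓ' : θΓ + ρb * KG ≤ θΓ')
    (hθC' : θC + ρb * (2 + ρb) * ((1 - ρb) ^ 2)⁻¹ * KCs ≤ θC')
    (hθE' : θE + ρb * (2 + ρb) * (θE + KE) ≤ θE')
    -- the capstone's numeric conditions in the primed letters, at the rate κ + a₀, with w₀
    (hθEle : θE' ≤ θ)
    (hθΓle : θΓ' ≤ θ)
    (hθR1le : ((𝔇.𝒦 Z t).m * (1 + 2 / (kap - kap')) ^ 𝔇.ν) * ((𝔇.𝒦 Z t).m * (1 + 2 / (kap' - kap'')) ^ 𝔇.ν)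
      * (θΓ' * KCs' * KG' + KΓ * θC' * KG' + KΓ * K₀ * θΓ') ≤ θ)
    (hsmallKθ : K₀ * ((𝔇.𝒦 Z t).m * (1 + 2 / kap) ^ 𝔇.ν) * (θ * ((𝔇.𝒦 Z t).m * (1 + 2 / kap'') ^ 𝔇.ν)) < 1)
    {cE g : ℝ}
    (hc0 : 0 ≤ cE)
    (hc : ∀ k, (𝔇.𝒦 Z t).hC.1.eigenvalues k ≤ cE)
    (hαc : (2 * (θ * ((𝔇.𝒦 Z t).m * (1 + 2 / kap'') ^ 𝔇.ν)) + (κ + a₀)) * cE ≤ 1 / 2)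
    (hg : 0 ≤ g)
    (hΓq : ∀ X : (𝔇.𝒦 Z t).Λ ⊕ (𝔇.𝒦 Z t).C₀ → ℝ, ((𝔇.𝒦 Z t).Γ₀ *ᵥ X) ⬝ᵥ ((𝔇.𝒦 Z t).C *ᵥ ((𝔇.𝒦 Z t).Γ₀ *ᵥ X)) ≤ g * (X ⬝ᵥ X))
    (hsmall : (2 * (θ * ((𝔇.𝒦 Z t).m * (1 + 2 / kap'') ^ 𝔇.ν)) + (κ + a₀)) * (1 + 2 * cE * g) ≤ 1 / 2)
    {a a₅ : ℝ}
    (hvol : 2 * (K₀ * ((𝔇.𝒦 Z t).m * (1 + 2 / kap) ^ 𝔇.ν) * (θ * ((𝔇.𝒦 Z t).m * (1 + 2 / kap'') ^ 𝔇.ν))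
              * (1 + (1 - K₀ * ((𝔇.𝒦 Z t).m * (1 + 2 / kap) ^ 𝔇.ν) * (θ * ((𝔇.𝒦 Z t).m * (1 + 2 / kap'') ^ 𝔇.ν)))⁻¹) / 2)
          * (Fintype.card (𝔇.𝒦 Z t).Λ : ℝ)
        + w₀ + (2 * (θ * ((𝔇.𝒦 Z t).m * (1 + 2 / kap'') ^ 𝔇.ν)) + (κ + a₀)) * cE * (Fintype.card (𝔇.𝒦 Z t).Λ : ℝ)
        + (2 * (θ * ((𝔇.𝒦 Z t).m * (1 + 2 / kap'') ^ 𝔇.ν)) + (κ + a₀)) * (1 + 2 * cE * g) * (Fintype.card ((𝔇.𝒦 Z t).Λ ⊕ (𝔇.𝒦 Z t).C₀) : ℝ)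
        ≤ a₅ * ((Z.1).card : ℝ))
    {b : ℂ}
    (hb : b ∈ ball (1 : ℂ) ρb) :
    ‖term214 𝔇.r (sigmaList L Z t) (tauList P M k L t)
        (core214 (fun σ => b ^ 2 • 𝔇.A Z t φ σ) (fun σ X => b • 𝔇.Gam Z t φ σ X)
          (F214 t.2.card (fun B => χu Z t (s₀ • B)) (fun B => χcu Z t (s₀ • B)) t.1 (fun Y _ => 𝒪 Z t old φ Y 0))) 0 0
      - term214 𝔇.r (sigmaList L Z t) (tauList P M k L t)
        (core214 (fun σ => b ^ 2 • 𝔇.A Z t φ σ) (fun σ X => b • 𝔇.Gam Z t φ σ X)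
          (F214 t.2.card (fun _ => 1) (fun _ => 1) t.1 (fun Y _ => 𝒪 Z t old φ Y 0))) 0 0‖ ≤
      Real.exp (-(κ / 2 * R ^ 2)) * (weight L M c Z a t * Real.exp (a₅ * ((Z.1).card : ℝ))) :=
  h226_torus_windowDilated_boxTail_of_primitives c hκ₁ hα₆ Z t hpos hhalf hUσ hUτ hUexp hUtau hr hr' hsubτ (sigmaList L Z t) (sigmaList_spec Z t) (tauList P M k L t) (tauList_spec t) (𝔇.A Z t φ) (𝔇.Gam Z t φ) (χY₀ := fun B => χu Z t (s₀ • B)) (χcP := fun B => χcu Z t (s₀ • B)) hχ0 hχc0 hχ1 hκ hbox t.1 (V₀ := fun Y _ => 𝒪 Z t old φ Y 0) (𝔇.𝒦 Z t).hC (𝔇.𝒦 Z t).Γ₀ hAhol hχm hχcm hV₀m hAs (fun σ => (𝔇.𝒦 Z t).G2 σ (𝔇.uOf Z t φ)) hGhol (fun _ _ _ => rfl) hP0 ha₀ h220U (𝔇.𝒦 Z t).locΛ (𝔇.𝒦 Z t).locN (𝔇.𝒦 Z t).hfib hfibN hkap'' hk1 hk2 hθE hθΓ hθC hKG hKΓ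 hKCs hK₀ hKE hG hΓ₀ hCs hC216 hCE hdΓ hdC hdE hρb1 hKG' hKCs' hθΓ' hθC' hθE' hθEle hθΓle hθR1le hsmallKθ hc0 hc hαc hg hΓq hsmall hvol hb

/-! ## §2 The box-free centre is coupling-blind: the box-free member with field-constant potentials does not depend on the dilation parameter -/

open Classical in
/-- **THE BOX-FREE CENTRE OF THE MEMBER FAMILY OF THE DATUM IS `b`-FREE, KERNEL-KEYED** — dag-n10-c g6 `B13Bound226BoxTail.term214_torus_windowDilated_boxFree_eq_of_primitives` (lens T25:
radial invariance + holomorphy on the ball, NO generating function) at the datum's kernel record: for every `b ∈ ball 1 ρ_b`,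
`term(b²A,bΓ,F214 |P| 1 1 𝐃 (Y ↦ 𝒪(old,φ,Y,0))) = term(A,Γ,F214 |P| 1 1 𝐃 (Y ↦ 𝒪(old,φ,Y,0)))` =: the COUPLING-BLIND CENTRE `V` of the term at `(old, φ)` (no base point, no
dilation parameter: the right-hand side is built from the datum's coupling-blind kernels and the older terms at ZERO unscaled fluctuation field).  Located inputs: the σ∕τ-regions and
Cauchy radius, kernel holomorphy∕symmetry, `Σ|τ||𝒪(old,φ,Y,0)| ≤ w₀` on the τ-region, the (L17a)∕(L16a) letters + `K_E`, `ρ_b < 1`, primed letters, the numeric conditions at any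
rate `α₀ ≥ 0`.  The `c t b = V` (third) piece of `B13Term214CentredPieces.centred_three_pieces`.  One application; nothing estimated here.
[cite: Balaban1988RG2Cluster, (2.14)-(2.15) p.15, (2.16)-(2.22) p.16, (2.23)-(2.25) p.17; Balaban1987RG1, (2.10)-(2.13) pp.267-268] -/
theorem boxFreeCentre_memberOfDatum_eq_of_primitives
    (Z : (domSys P M (k + 1)).Dom) (t : TermLabel P M k L) (old : OlderTerms P 𝔸 M k) (φ : CPair P 𝔸)
    (c : B13.Consts)
    {Uσ : Set ℂ}
    {Uτ : TDom P.d (L * domCount P M (k + 1)) → Set ℂ}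
    (hUσ : IsOpen Uσ)
    (hUτ : ∀ Y, IsOpen (Uτ Y))
    (hUexp : closedBall (0 : ℂ) (Real.exp c.κ₁) ⊆ Uσ)
    (hr : 0 < 𝔇.r)
    (hr' : 𝔇.r ≤ Real.exp c.κ₁ - 1)
    (hsubτ : ∀ Y, ∀ s ∈ Set.uIcc (0 : ℝ) 1, closedBall (s : ℂ) 𝔇.r ⊆ Uτ Y)
    (hAhol : ∀ i j, DifferentiableOn ℂ (fun σ => 𝔇.A Z t φ σ i j) {σ | ∀ j, σ j ∈ Uσ})
    (hAs : ∀ σ : TPt P.d (domCount P M (k + 1)) → ℂ, (∀ j, σ j ∈ Uσ) → (𝔇.A Z t φ σ).IsSymm)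
    (hGhol : ∀ i j, DifferentiableOn ℂ (fun σ => (𝔇.𝒦 Z t).G2 σ (𝔇.uOf Z t φ) i j) {σ | ∀ j, σ j ∈ Uσ})
    {w₀ : ℝ}
    (hw₀U : ∀ τ : TDom P.d (L * domCount P M (k + 1)) → ℂ, (∀ Y, τ Y ∈ Uτ Y) → ∑ Y ∈ t.1, ‖τ Y‖ * ‖𝒪 Z t old φ Y 0‖ ≤ w₀)
    (hfibN : ∀ x : UT 𝔇.Nf, (Finset.univ.filter fun j => (𝔇.𝒦 Z t).locN j = x).card ≤ (𝔇.𝒦 Z t).m)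
    {kap kap' kap'' θ θE θΓ θC KG KΓ KCs K₀ KE : ℝ}
    (hkap'' : 0 < kap'')
    (hk1 : kap'' < kap')
    (hk2 : kap' < kap)
    (hθE : 0 ≤ θE)
    (hθΓ : 0 ≤ θΓ)
    (hθC : 0 ≤ θC)
    (hKG : 0 ≤ KG)
    (hKΓ : 0 ≤ KΓ)
    (hKCs : 0 ≤ KCs)
    (hK₀ : 0 ≤ K₀)
    (hKE : 0 ≤ KE)
    (hG : ∀ σ : TPt P.d (domCount P M (k + 1)) → ℂ, (∀ j, σ j ∈ Uσ) →
      ∀ b j, ‖(𝔇.𝒦 Z t).G2 σ (𝔇.uOf Z t φ) b j‖ ≤ KG * Real.exp (-(kap * tdist1 𝔇.Nf ((𝔇.𝒦 Z t).locΛ b) ((𝔇.𝒦 Z t).locN j))))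
    (hΓ₀ : ∀ b j, ‖(𝔇.𝒦 Z t).Γ₀ b j‖ ≤ KΓ * Real.exp (-(kap * tdist1 𝔇.Nf ((𝔇.𝒦 Z t).locΛ b) ((𝔇.𝒦 Z t).locN j))))
    (hCs : ∀ σ : TPt P.d (domCount P M (k + 1)) → ℂ, (∀ j, σ j ∈ Uσ) →
      ∀ b b', ‖(𝔇.A Z t φ σ)⁻¹ b b'‖ ≤ KCs * Real.exp (-(kap * tdist1 𝔇.Nf ((𝔇.𝒦 Z t).locΛ b) ((𝔇.𝒦 Z t).locΛ b'))))
    (hC216 : ∀ b b', ‖(𝔇.𝒦 Z t).C b b'‖ ≤ K₀ * Real.exp (-(kap * tdist1 𝔇.Nf ((𝔇.𝒦 Z t).locΛ b) ((𝔇.𝒦 Z t).locΛ b'))))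
    (hCE : ∀ b b', ‖((𝔇.𝒦 Z t).C⁻¹.map (algebraMap ℝ ℂ)) b b'‖ ≤ KE * Real.exp (-(kap * tdist1 𝔇.Nf ((𝔇.𝒦 Z t).locΛ b) ((𝔇.𝒦 Z t).locΛ b'))))
    (hdΓ : ∀ σ : TPt P.d (domCount P M (k + 1)) → ℂ, (∀ j, σ j ∈ Uσ) →
      ∀ b j, ‖((𝔇.𝒦 Z t).G2 σ (𝔇.uOf Z t φ) - (𝔇.𝒦 Z t).Γ₀.map (algebraMap ℝ ℂ)) b j‖ ≤ θΓ * Real.exp (-(kap * tdist1 𝔇.Nf ((𝔇.𝒦 Z t).locΛ b) ((𝔇.𝒦 Z t).locN j))))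
    (hdC : ∀ σ : TPt P.d (domCount P M (k + 1)) → ℂ, (∀ j, σ j ∈ Uσ) →
      ∀ b b', ‖((𝔇.A Z t φ σ)⁻¹ - (𝔇.𝒦 Z t).C.map (algebraMap ℝ ℂ)) b b'‖
        ≤ θC * Real.exp (-(kap * tdist1 𝔇.Nf ((𝔇.𝒦 Z t).locΛ b) ((𝔇.𝒦 Z t).locΛ b'))))
    (hdE : ∀ σ : TPt P.d (domCount P M (k + 1)) → ℂ, (∀ j, σ j ∈ Uσ) →
      ∀ b b', ‖(𝔇.A Z t φ σ - (𝔇.𝒦 Z t).C⁻¹.map (algebraMap ℝ ℂ)) b b'‖ ≤ θE * Real.exp (-(kap * tdist1 𝔇.Nf ((𝔇.𝒦 Z t).locΛ b) ((𝔇.𝒦 Z t).locΛ b'))))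
    {ρb KG' KCs' θΓ' θC' θE' : ℝ}
    (hρb1 : ρb < 1)
    (hKG' : (1 + ρb) * KG ≤ KG')
    (hKCs' : ((1 - ρb) ^ 2)⁻¹ * KCs ≤ KCs')
    (hθΓ' : θΓ + ρb * KG ≤ θΓ')
    (hθC' : θC + ρb * (2 + ρb) * ((1 - ρb) ^ 2)⁻¹ * KCs ≤ θC')
    (hθE' : θE + ρb * (2 + ρb) * (θE + KE) ≤ θE')
    (hθEle : θE' ≤ θ)
    (hθΓle : θΓ' ≤ θ)
    (hθR1le : ((𝔇.𝒦 Z t).m * (1 + 2 / (kap - kap')) ^ 𝔇.ν) * ((𝔇.𝒦 Z t).m * (1 + 2 / (kap' - kap'')) ^ 𝔇.ν)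
      * (θΓ' * KCs' * KG' + KΓ * θC' * KG' + KΓ * K₀ * θΓ') ≤ θ)
    (hsmallKθ : K₀ * ((𝔇.𝒦 Z t).m * (1 + 2 / kap) ^ 𝔇.ν) * (θ * ((𝔇.𝒦 Z t).m * (1 + 2 / kap'') ^ 𝔇.ν)) < 1)
    {cE g : ℝ}
    (hc0 : 0 ≤ cE)
    (hc : ∀ k, (𝔇.𝒦 Z t).hC.1.eigenvalues k ≤ cE)
    {α₀ : ℝ}
    (hα₀ : 0 ≤ α₀)
    (hαc : (2 * (θ * ((𝔇.𝒦 Z t).m * (1 + 2 / kap'') ^ 𝔇.ν)) + α₀) * cE ≤ 1 / 2)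
    (hΓq : ∀ X : (𝔇.𝒦 Z t).Λ ⊕ (𝔇.𝒦 Z t).C₀ → ℝ, ((𝔇.𝒦 Z t).Γ₀ *ᵥ X) ⬝ᵥ ((𝔇.𝒦 Z t).C *ᵥ ((𝔇.𝒦 Z t).Γ₀ *ᵥ X)) ≤ g * (X ⬝ᵥ X))
    (hsmall : (2 * (θ * ((𝔇.𝒦 Z t).m * (1 + 2 / kap'') ^ 𝔇.ν)) + α₀) * (1 + 2 * cE * g) ≤ 1 / 2) :
    ∀ b ∈ ball (1 : ℂ) ρb,
      term214 𝔇.r (sigmaList L Z t) (tauList P M k L t)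
        (core214 (fun σ => b ^ 2 • 𝔇.A Z t φ σ) (fun σ X => b • 𝔇.Gam Z t φ σ X)
          (F214 t.2.card (fun _ => 1) (fun _ => 1) t.1 (fun Y _ => 𝒪 Z t old φ Y 0))) 0 0
        = term214 𝔇.r (sigmaList L Z t) (tauList P M k L t)
        (core214 (𝔇.A Z t φ) (𝔇.Gam Z t φ) (F214 t.2.card (fun _ => 1) (fun _ => 1) t.1 (fun Y _ => 𝒪 Z t old φ Y 0))) 0 0 :=
  term214_torus_windowDilated_boxFree_eq_of_primitives c hUσ hUτ hUexp hr hr' hsubτ (lZ := (sigmaList L Z t)) (sigmaList_spec Z t).1 (lD := (tauList P M k L t)) (tauList_spec t).1 (𝔇.A Z t φ) (𝔇.Gam Z t φ) t.2.card t.1 (fun Y => 𝒪 Z t old φ Y 0) (𝔇.𝒦 Z t).hC (𝔇.𝒦 Z t).Γ₀ hAhol hAs (fun σ => (𝔇.𝒦 Z t).G2 σ (𝔇.uOf Z t φ)) hGhol (fun _ _ _ => rfl) hw₀U (𝔇.𝒦 Z t).locΛ (𝔇.𝒦 Z t).locN (𝔇.𝒦 Z t).hfib hfibN hkap'' hk1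 hk2 hθE hθΓ hθC hKG hKΓ hKCs hK₀ hKE hG hΓ₀ hCs hC216 hCE hdΓ hdC hdE hρb1 hKG' hKCs' hθΓ' hθC' hθE' hθEle hθΓle hθR1le hsmallKθ hc0 hc hα₀ hαc hΓq hsmall

/-! ## §3 The large-field members (`P(t) ≠ ∅`): the (2.22) surplus in front of the (2.26) weight -/

open Classical in
/-- **THE LARGE-FIELD MEMBERS OF THE DATUM ARE SMALL, KERNEL-KEYED (`P(t) ≠ ∅`)** — dag-n10-c g6 `B13Bound226BoxTail.h226_torus_windowDilated_largeField_of_primitives` at the datum's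
kernel record: for the window-dilated member of base point `s₀` (J5's family) of a term WITH large-field boxes (`1 ≤ |P(t)|`), for every `b ∈ ball 1 ρ_b`,
`‖m(s₀, b)‖ ≤ e^{−½γ₂(r_P² − r₁²)}·(weight L M c Z a t·e^{a₅|Z|})` — the (2.22) surplus at the box radius `r_P` over a smaller radius `r₁` carrying the weight's `|P|`-rate
(`hPa : a ≤ γ₂r₁²`).  Located inputs: J6's list (boxes at `s₀` with (2.22) at radius `r_P`, the split potentials with the joint (2.20), kernel letters + `K_E`, `ρ_b < 1`, primed
letters, numerics in the primed letters) + `r₁² ≤ r_P²`, `1 ≤ |P(t)|`.  With `r_P = ε₁∕s₀`-type growth, `e^{−½γ₂(r_P²−r₁²)} ≤ s₀²·T_P` makes these members' whole value an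
(S-vertex-T′)ʷ letter about the centre `V := 0`.  One application; no estimate proved here.
[cite: Balaban1988RG2Cluster, (2.3) p.12, (2.14)-(2.15) p.15, (2.22) p.16, (2.23)-(2.26) p.17; Balaban1987RG1, (2.9)-(2.13) pp.266-268] -/
theorem norm_memberOfDatum_le_largeField_of_primitives
    (Z : (domSys P M (k + 1)).Dom) (t : TermLabel P M k L) (old : OlderTerms P 𝔸 M k) (φ : CPair P 𝔸) (s₀ : ℝ)
    (c : B13.Consts)
    (hκ₁ : 1 ≤ c.κ₁)
    (hα₆ : c.α₆ ≠ 0)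
    (hpos : ∀ Y : TDom P.d (L * domCount P M (k + 1)), 0 < invTau c ((tsys P.d (L * domCount P M (k + 1))).dj Y))
    (hhalf : ∀ Y : TDom P.d (L * domCount P M (k + 1)), invTau c ((tsys P.d (L * domCount P M (k + 1))).dj Y) ≤ 1 / 2)
    {Uσ : Set ℂ}
    {Uτ : TDom P.d (L * domCount P M (k + 1)) → Set ℂ}
    (hUσ : IsOpen Uσ)
    (hUτ : ∀ Y, IsOpen (Uτ Y))
    (hUexp : closedBall (0 : ℂ) (Real.exp c.κ₁) ⊆ Uσ)
    (hUtau : ∀ Y : TDom P.d (L * domCount P M (k + 1)), closedBall (0 : ℂ) ((invTau c ((tsys P.d (L * domCount P M (k + 1))).dj Y))⁻¹) ⊆ Uτ Y)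
    (hr : 0 < 𝔇.r)
    (hr' : 𝔇.r ≤ Real.exp c.κ₁ - 1)
    (hsubτ : ∀ Y, ∀ s ∈ Set.uIcc (0 : ℝ) 1, closedBall (s : ℂ) 𝔇.r ⊆ Uτ Y)
    (hχ0 : ∀ B, 0 ≤ χu Z t (s₀ • B))
    (hχc0 : ∀ B, 0 ≤ χcu Z t (s₀ • B))
    (hAhol : ∀ i j, DifferentiableOn ℂ (fun σ => 𝔇.A Z t φ σ i j) {σ | ∀ j, σ j ∈ Uσ})
    (hχm : Measurable fun B : (𝔇.𝒦 Z t).Λ → ℝ => χu Z t (s₀ • B))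
    (hχcm : Measurable fun B : (𝔇.𝒦 Z t).Λ → ℝ => χcu Z t (s₀ • B))
    (hWm : ∀ Y, Measurable fun B : (𝔇.𝒦 Z t).Λ → ℝ => 𝒲 Z t φ Y (s₀ • B))
    (hOm : ∀ Y, Measurable fun B : (𝔇.𝒦 Z t).Λ → ℝ => 𝒪 Z t old φ Y (s₀ • B))
    (hAs : ∀ σ : TPt P.d (domCount P M (k + 1)) → ℂ, (∀ j, σ j ∈ Uσ) → (𝔇.A Z t φ σ).IsSymm)
    (hGhol : ∀ i j, DifferentiableOn ℂ (fun σ => (𝔇.𝒦 Z t).G2 σ (𝔇.uOf Z t φ) i j) {σ | ∀ j, σ j ∈ Uσ})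
    -- (2.22) at radius r_P with |P| ≥ 1, a smaller radius r′; the joint (2.20) shape of |W| + |O|
    {γ₂ rP r₁ a₂₀ w : ℝ}
    (qP : ((𝔇.𝒦 Z t).Λ → ℝ) → ℝ)
    (h222 : ∀ B, χu Z t (s₀ • B) * χcu Z t (s₀ • B) ≤ Real.exp (-(γ₂ / 2 * rP ^ 2 * (t.2.card : ℕ)) + γ₂ / 2 * qP B))
    (hγ₂ : 0 ≤ γ₂)
    (hqP : ∀ B, qP B ≤ B ⬝ᵥ B)
    (hr₁ : r₁ ^ 2 ≤ rP ^ 2)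
    (hP1 : 1 ≤ t.2.card)
    (ha0 : 0 ≤ a₂₀)
    (h220U : ∀ τ : TDom P.d (L * domCount P M (k + 1)) → ℂ, (∀ Y, τ Y ∈ Uτ Y) →
      ∀ B, ∑ Y ∈ t.1, ‖τ Y‖ * (‖(((s₀ : ℝ) : ℂ) ^ 2)⁻¹ * 𝒲 Z t φ Y (s₀ • B)‖ + ‖𝒪 Z t old φ Y (s₀ • B)‖) ≤ a₂₀ / 2 * (B ⬝ᵥ B) + w)
    (hfibN : ∀ x : UT 𝔇.Nf, (Finset.univ.filter fun j => (𝔇.𝒦 Z t).locN j = x).card ≤ (𝔇.𝒦 Z t).m)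
    {kap kap' kap'' θ θE θΓ θC KG KΓ KCs K₀ KE : ℝ}
    (hkap'' : 0 < kap'')
    (h1 : kap'' < kap')
    (h2 : kap' < kap)
    (hθE : 0 ≤ θE)
    (hθΓ : 0 ≤ θΓ)
    (hθC : 0 ≤ θC)
    (hKG : 0 ≤ KG)
    (hKΓ : 0 ≤ KΓ)
    (hKCs : 0 ≤ KCs)
    (hK₀ : 0 ≤ K₀)
    (hKE : 0 ≤ KE)
    (hG : ∀ σ : TPt P.d (domCount P M (k + 1)) → ℂ, (∀ j, σ j ∈ Uσ) →
      ∀ b j, ‖(𝔇.𝒦 Z t).G2 σ (𝔇.uOf Z t φ) b j‖ ≤ KG * Real.exp (-(kap * tdist1 𝔇.Nf ((𝔇.𝒦 Z t).locΛ b) ((𝔇.𝒦 Z t).locN j))))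
    (hΓ₀ : ∀ b j, ‖(𝔇.𝒦 Z t).Γ₀ b j‖ ≤ KΓ * Real.exp (-(kap * tdist1 𝔇.Nf ((𝔇.𝒦 Z t).locΛ b) ((𝔇.𝒦 Z t).locN j))))
    (hCs : ∀ σ : TPt P.d (domCount P M (k + 1)) → ℂ, (∀ j, σ j ∈ Uσ) →
      ∀ b b', ‖(𝔇.A Z t φ σ)⁻¹ b b'‖ ≤ KCs * Real.exp (-(kap * tdist1 𝔇.Nf ((𝔇.𝒦 Z t).locΛ b) ((𝔇.𝒦 Z t).locΛ b'))))
    (hC216 : ∀ b b', ‖(𝔇.𝒦 Z t).C b b'‖ ≤ K₀ * Real.exp (-(kap * tdist1 𝔇.Nf ((𝔇.𝒦 Z t).locΛ b) ((𝔇.𝒦 Z t).locΛ b'))))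
    (hCE : ∀ b b', ‖((𝔇.𝒦 Z t).C⁻¹.map (algebraMap ℝ ℂ)) b b'‖ ≤ KE * Real.exp (-(kap * tdist1 𝔇.Nf ((𝔇.𝒦 Z t).locΛ b) ((𝔇.𝒦 Z t).locΛ b'))))
    (hdΓ : ∀ σ : TPt P.d (domCount P M (k + 1)) → ℂ, (∀ j, σ j ∈ Uσ) →
      ∀ b j, ‖((𝔇.𝒦 Z t).G2 σ (𝔇.uOf Z t φ) - (𝔇.𝒦 Z t).Γ₀.map (algebraMap ℝ ℂ)) b j‖ ≤ θΓ * Real.exp (-(kap * tdist1 𝔇.Nf ((𝔇.𝒦 Z t).locΛ b) ((𝔇.𝒦 Z t).locN j))))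
    (hdC : ∀ σ : TPt P.d (domCount P M (k + 1)) → ℂ, (∀ j, σ j ∈ Uσ) →
      ∀ b b', ‖((𝔇.A Z t φ σ)⁻¹ - (𝔇.𝒦 Z t).C.map (algebraMap ℝ ℂ)) b b'‖
        ≤ θC * Real.exp (-(kap * tdist1 𝔇.Nf ((𝔇.𝒦 Z t).locΛ b) ((𝔇.𝒦 Z t).locΛ b'))))
    (hdE : ∀ σ : TPt P.d (domCount P M (k + 1)) → ℂ, (∀ j, σ j ∈ Uσ) →
      ∀ b b', ‖(𝔇.A Z t φ σ - (𝔇.𝒦 Z t).C⁻¹.map (algebraMap ℝ ℂ)) b b'‖ ≤ θE * Real.exp (-(kap * tdist1 𝔇.Nf ((𝔇.𝒦 Z t).locΛ b) ((𝔇.𝒦 Z t).locΛ b'))))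
    {ρb KG' KCs' θΓ' θC' θE' a' w' : ℝ}
    (hρb1 : ρb < 1)
    (hKG' : (1 + ρb) * KG ≤ KG')
    (hKCs' : ((1 - ρb) ^ 2)⁻¹ * KCs ≤ KCs')
    (hθΓ' : θΓ + ρb * KG ≤ θΓ')
    (hθC' : θC + ρb * (2 + ρb) * ((1 - ρb) ^ 2)⁻¹ * KCs ≤ θC')
    (hθE' : θE + ρb * (2 + ρb) * (θE + KE) ≤ θE')
    (ha' : (1 + ρb) ^ 2 * a₂₀ ≤ a')
    (hw' : (1 + ρb) ^ 2 * w ≤ w')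
    (hθEle : θE' ≤ θ)
    (hθΓle : θΓ' ≤ θ)
    (hθR1le : ((𝔇.𝒦 Z t).m * (1 + 2 / (kap - kap')) ^ 𝔇.ν) * ((𝔇.𝒦 Z t).m * (1 + 2 / (kap' - kap'')) ^ 𝔇.ν)
      * (θΓ' * KCs' * KG' + KΓ * θC' * KG' + KΓ * K₀ * θΓ') ≤ θ)
    (hsmallKθ : K₀ * ((𝔇.𝒦 Z t).m * (1 + 2 / kap) ^ 𝔇.ν) * (θ * ((𝔇.𝒦 Z t).m * (1 + 2 / kap'') ^ 𝔇.ν)) < 1)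
    {cE g : ℝ}
    (hc0 : 0 ≤ cE)
    (hc : ∀ k, (𝔇.𝒦 Z t).hC.1.eigenvalues k ≤ cE)
    (hαc : (2 * (θ * ((𝔇.𝒦 Z t).m * (1 + 2 / kap'') ^ 𝔇.ν)) + (γ₂ + a')) * cE ≤ 1 / 2)
    (hg : 0 ≤ g)
    (hΓq : ∀ X : (𝔇.𝒦 Z t).Λ ⊕ (𝔇.𝒦 Z t).C₀ → ℝ, ((𝔇.𝒦 Z t).Γ₀ *ᵥ X) ⬝ᵥ ((𝔇.𝒦 Z t).C *ᵥ ((𝔇.𝒦 Z t).Γ₀ *ᵥ X)) ≤ g * (X ⬝ᵥ X))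
    (hsmall : (2 * (θ * ((𝔇.𝒦 Z t).m * (1 + 2 / kap'') ^ 𝔇.ν)) + (γ₂ + a')) * (1 + 2 * cE * g) ≤ 1 / 2)
    -- constant matching at the SMALLER radius r₁
    {a a₅ : ℝ}
    (hPa : a ≤ γ₂ * r₁ ^ 2)
    (hvol : 2 * (K₀ * ((𝔇.𝒦 Z t).m * (1 + 2 / kap) ^ 𝔇.ν) * (θ * ((𝔇.𝒦 Z t).m * (1 + 2 / kap'') ^ 𝔇.ν))
              * (1 + (1 - K₀ * ((𝔇.𝒦 Z t).m * (1 + 2 / kap) ^ 𝔇.ν) * (θ * ((𝔇.𝒦 Z t).m * (1 + 2 / kap'') ^ 𝔇.ν)))⁻¹) / 2)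
          * (Fintype.card (𝔇.𝒦 Z t).Λ : ℝ)
        + w' + (2 * (θ * ((𝔇.𝒦 Z t).m * (1 + 2 / kap'') ^ 𝔇.ν)) + (γ₂ + a')) * cE * (Fintype.card (𝔇.𝒦 Z t).Λ : ℝ)
        + (2 * (θ * ((𝔇.𝒦 Z t).m * (1 + 2 / kap'') ^ 𝔇.ν)) + (γ₂ + a')) * (1 + 2 * cE * g) * (Fintype.card ((𝔇.𝒦 Z t).Λ ⊕ (𝔇.𝒦 Z t).C₀) : ℝ)
        ≤ a₅ * ((Z.1).card : ℝ))
    {b : ℂ}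
    (hb : b ∈ ball (1 : ℂ) ρb) :
    ‖term214 𝔇.r (sigmaList L Z t) (tauList P M k L t)
        (core214 (fun σ => b ^ 2 • 𝔇.A Z t φ σ) (fun σ X => b • 𝔇.Gam Z t φ σ X)
          (F214 t.2.card (fun B => χu Z t (s₀ • B)) (fun B => χcu Z t (s₀ • B)) t.1
            (fun Y B => b ^ 2 * ((((s₀ : ℝ) : ℂ) ^ 2)⁻¹ * 𝒲 Z t φ Y (s₀ • B)) + 𝒪 Z t old φ Y (s₀ • B)))) 0 0‖ ≤
      Real.exp (-(γ₂ / 2 * (rP ^ 2 - r₁ ^ 2))) * (weight L M c Z a t * Real.exp (a₅ * ((Z.1).card : ℝ))) := by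
  have hWm' : ∀ Y, Measurable fun B : (𝔇.𝒦 Z t).Λ → ℝ => (((s₀ : ℝ) : ℂ) ^ 2)⁻¹ * 𝒲 Z t φ Y (s₀ • B) := fun Y => (hWm Y).const_mul _
  exact h226_torus_windowDilated_largeField_of_primitives c hκ₁ hα₆ Z t hpos hhalf hUσ hUτ hUexp hUtau hr hr' hsubτ (sigmaList L Z t) (sigmaList_spec Z t) (tauList P M k L t) (tauList_spec t) (𝔇.A Z t φ) (𝔇.Gam Z t φ) (fun B => χu Z t (s₀ • B)) (fun B => χcu Z t (s₀ • B)) hχ0 hχc0 t.1 (fun Y B => (((s₀ : ℝ) : ℂ) ^ 2)⁻¹ * 𝒲 Z t φ Y (s₀ • B)) (fun Y B => 𝒪 Z t old φ Y (s₀ • B)) (𝔇.𝒦 Z t).hC (𝔇.𝒦 Z t).Γ₀ hAhol hχm hχcm hWm' hOm hAs (fun σ => (𝔇.𝒦 Z t).G2 σ (𝔇.uOf Z t φ)) hGhol (fun _ _ _ => rfl) qP h222 hγ₂ hqP hr₁ hP1 ha0 h220U (𝔇.𝒦 Z t).locΛ (𝔇.𝒦 Z t).locN (𝔇.𝒦 Z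 t).hfib hfibN hkap'' h1 h2 hθE hθΓ hθC hKG hKΓ hKCs hK₀ hKE hG hΓ₀ hCs hC216 hCE hdΓ hdC hdE hρb1 hKG' hKCs' hθΓ' hθC' hθE' ha' hw' hθEle hθΓle hθR1le hsmallKθ hc0 hc hαc hg hΓq hsmall hPa hvol hb

/-! ## §4 The assembly algebra in J2's `hMcen` shape: centred piece + box tail + `b`-free centre (P = ∅), large-field surplus (P ≠ ∅), and the rates `≤ T·s₀²` -/

/-- **(S-vertex-T′)ʷ FROM THE THREE PIECES, `P = ∅`** — in the exact shape of J2's `hMcen` slot `Mv * s₀ ^ 2 * W`: the centred piece `‖m − c₁‖ ≤ s₀²·W` (dag-n10-c `B13Bound226Centred(Rem)` at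
the datum — J7b), the box tail `‖c₁ − c‖ ≤ e^{−½κR²}·W` (§1), the `b`-free centre `c = V` (§2) and the rate `e^{−½κR²} ≤ T·s₀²` (`B13Term214CentredPieces.boxTail_rate` with `R = ε₁∕s₀`,
`T = 2∕(eκε₁²)` base-point-free) give `‖m − V‖ ≤ (1 + T)·s₀²·W` (`B13Term214CentredPieces.centred_three_pieces`, reshaped). [cite: Balaban1987RG1, (2.12)-(2.13) p.268] (elementary) -/
theorem vertexLetter_of_threePieces {m c₁ cb V : ℂ} {s₀ W κ R T : ℝ} (hW : 0 ≤ W) (h1 : ‖m - c₁‖ ≤ s₀ ^ 2 * W)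
    (h2 : ‖c₁ - cb‖ ≤ Real.exp (-(κ / 2 * R ^ 2)) * W) (h3 : cb = V) (hR : Real.exp (-(κ / 2 * R ^ 2)) ≤ T * s₀ ^ 2) :
    ‖m - V‖ ≤ (1 + T) * s₀ ^ 2 * W := by
  have h2' : ‖c₁ - cb‖ ≤ T * s₀ ^ 2 * W := h2.trans (mul_le_mul_of_nonneg_right hR hW)
  have e : m - V = (m - c₁) + (c₁ - cb) := by rw [← h3]; ring
  rw [e]
  refine (norm_add_le _ _).trans ?_
  calc ‖m - c₁‖ + ‖c₁ - cb‖ ≤ s₀ ^ 2 * W + T * s₀ ^ 2 * W := add_le_add h1 h2'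
    _ = (1 + T) * s₀ ^ 2 * W := by ring

/-- **(S-vertex-T′)ʷ FOR A LARGE-FIELD MEMBER, `P ≠ ∅`, ABOUT THE CENTRE `0`** — `‖m‖ ≤ e^{q}·W` (§3, `q = −½γ₂(r_P²−r₁²)`) and the rate `e^{q} ≤ T·s₀²` give `‖m − 0‖ ≤ T·s₀²·W`.
[cite: Balaban1988RG2Cluster, (2.22) p.16] (elementary) -/
theorem vertexLetter_of_largeField {m : ℂ} {s₀ W q T : ℝ} (hW : 0 ≤ W) (h : ‖m‖ ≤ Real.exp q * W) (hT : Real.exp q ≤ T * s₀ ^ 2) :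
    ‖m - 0‖ ≤ T * s₀ ^ 2 * W := by
  rw [sub_zero]
  exact h.trans (mul_le_mul_of_nonneg_right hT hW)

/-- **THE CASE SPLIT ON THE LARGE-FIELD SET** — the coupling-blind centre of J2 for the member family of the datum is `V := if P(t) = ∅ then (box-free centre) else 0`; with ONE `Mv`
dominating `1 + T` and `T_P` the two letters above give J2's `hMcen` conjunct `‖m − V‖ ≤ Mv·s₀²·W`. [cite: Balaban1987RG1, (2.13) p.268] (elementary) -/
theorem vertexLetter_byCases {P0 : Prop} [Decidable P0] {m cV : ℂ} {s₀ W T T' Mv : ℝ} (hW : 0 ≤ W)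
    (h0 : P0 → ‖m - cV‖ ≤ (1 + T) * s₀ ^ 2 * W) (h1 : ¬P0 → ‖m - 0‖ ≤ T' * s₀ ^ 2 * W) (hMv : 1 + T ≤ Mv) (hMv' : T' ≤ Mv) :
    ‖m - (if P0 then cV else 0)‖ ≤ Mv * s₀ ^ 2 * W := by
  have hsW : 0 ≤ s₀ ^ 2 * W := mul_nonneg (sq_nonneg _) hW
  split_ifs with h
  · exact (h0 h).trans (by nlinarith [mul_le_mul_of_nonneg_right hMv hsW])
  · exact (h1 h).trans (by nlinarith [mul_le_mul_of_nonneg_right hMv' hsW])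

end YMDAG.N22.W1

end
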